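import Summits.QuantumFields.BalabanUV.T4Continuum.Support.B13Base
import Summits.QuantumFields.BalabanUV.T4Continuum.Support.B13HistInsertion
import Summits.QuantumFields.BalabanUV.T4Continuum.Support.B13OpDatum

/-!
# NE5 ∕ U3 — row O1-f ADMISSIBLE BASE, part 2: leaf L03's history half for the insertion class ACTUALLY TYPED BY ROW O1-c
# (`B13HistInsertion.InsDatum`: `ins k a t = base k a + Σ_{j<k} ω^{k−1−j} • slice k j a t`) — run B's (1.36)-budget ⇐ the printed
# one-run level `DecayBound EB` (leaf L06) + ONE age-free slice budget at run B's insertion-operator datum (the B-twin of row O1-c's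
# displayed W3 binder `SliceBudget`); `InBase ∧ BaseBudget` for the installed budget box (claim table
# `t4/b2b-balaban-t4-ne5-p1/O1-CLAIM-TABLE-NE5-P1.md` rows O1-f∕O1-c; design `B13StepDesign.md` v0.2 RULES R3∕R3′∕R5∕R6)

Cell `pub-balaban`, unit `b2b-balaban-t4-ne5-formalise-leaf-03` (NE5 formalisation swarm, LEAF PROVER 03; row O1-f, journal CLAIM
2026-08-20T05:31:32Z; part 1 = `Support/B13Base.lean` p207657).  Summits-side new work under the LEAN PLACEMENT RULE (cell modelling +
bookkeeping; NOT a Literature module).  HONEST FRAMING: rung (B)+1 of the FINITE-VOLUME T⁴ continuum programme — NOT infinite volume,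
NOT a mass gap, NOT the Clay problem, NOT a proof of NE5 (NOT PRINTED in [Balaban1987RG1]–[Balaban1989LargeFieldII]; they print
ε-UNIFORM bounds, never η-RATES).  HONEST DEPENDENCY (cell line, verbatim): continuum YM on T⁴ ⇐ BetaPertH ∧ nine spine estimates
(0/9 proved); BetaPertH ⇐ (D1) ∧ (D4) ∧ CAP+tail; G-an2-4 gates asym, D1 and NE2/3/4.

WHAT THIS FILE DOES.  Part 1 (`B13Base`) proved leaf L03 `InBase ↔ OpBudgetB ∧ HistBudgetB` for the budget-box base and derived
`HistBudgetB` through the FINITE-RANK linear class `InsertionLinearClass.LinearInsertion`.  Row O1-c (`B13HistInsertion`, leaf-06,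
p207799) types Bałaban's insertion instead as an `InsDatum` — base part `base k a` + AGE-WEIGHTED sum of AGE-FREE single-scale slices
`slice k j a` (additive, ℝ-homogeneous, scale-`j`-local), read at the runs' insertion-operator data `insOpA ∕ insOpB` — with ONE
displayed one-run binder `SliceBudget` (at run A's datum).  This file runs THE (1.36) MECHANISM on that class, no estimate anywhere:
* §1 `SliceBudgetAt D M W κ c aOf` — the slice budget at an ARBITRARY datum map; `sliceBudgetAt_insOpA : … D.insOpA ↔ D.SliceBudget`
  (`Iff.rfl`: row O1-c's binder BY NAME); run B's instance `SliceBudgetAt … D.insOpB` is its B-twin (same KIND: the `j`-th term of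
  the one-run sums (1.24)∕(1.29)∕(1.36) of [Balaban1988RG2Cluster] at the inductive level, before the age factor — displayed, not
  asserted); `norm_ins_sub_base_le_insDatum`: a table of one-run level `T·e^{−κd}` below scale `k` moves `ins k a` off `base k a` by
  at most `T · rHist k · c/(1 − ω)` (slice locality `slice_local` + the slice budget scale by scale + the geometric age sum
  `B13Base.sum_pow_age_pred_le`);
* §2 `histBudgetB_of_insDatum`: `ReadsB ∧ SliceBudgetAt … insOpB ∧ DecayBound EB W E₀ κ` (leaf L06, [Balaban1987RG1] (1.18) p. 263 —
  quoted SHAPE) `⟹ HistBudgetB M EB W ctr (k ↦ E₀·rHist k·c/(1 − ω))` about a centre whose history component is run B's base part;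
  the A-twin `histBudgetA_of_insDatum` (row O1-c's own `SliceBudget` + L05 + a displayed bound `β k` on the distance of run A's base
  part from the centre) feeds the secant face's `HistBudgetA` BY NAME;
* §3 assembled for the owner's `B13Step`: `insDatumBudgetBase M D E₀ c` = the budget box about `selfCtr M (baseB D)` with budgets
  `(0, E₀·rHist·c/(1 − ω))`; `inBase_baseBudget_of_insDatum`: `ReadsB ∧ SliceBudgetAt … insOpB ∧ DecayBound EB` (+ signs, `ω < 1`)
  ⟹ `InBase ∧ BaseBudget` for `M.withBase (insDatumBudgetBase …)`; `boxInClass_of_insDatum` (room ⟹ slack of the roomy ball class);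
* §4 the OPERATOR half of L03 in row O1-b's typing (`B13OpDatum`, leaf-07, p207653: `OpDatum E = ℓ^∞` of format-normalised entries,
  `opB = assemble F raw`, one-run format bound `InFormat F raw R` — (1.5)∕(1.7)-KIND, displayed): `opBudgetB_of_inFormat` — the
  ZERO-CENTRED format-ball dictionary (`ctr.1 = 0`, `BOp = R`; `norm_assemble_le` BY NAME) — the alternative to part 1's self-centred
  `opBudgetB_selfCtr` (budget `0`); which centre `B13Step` uses is the owner's call (design Q5∕R5);
* §5 a toy `InsDatum` on `InsertionLinearClass.linToyCarriers` (non-vacuity: every hypothesis met, conclusion non-trivial).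
WHAT REMAINS OPEN (honest): that Bałaban's §1-potentials ARE such an `InsDatum` with these budgets is rows O1-c∕O4 (typing + readings)
and the wall O3 for the slice budgets themselves; nothing of the manuscripts under audit is asserted (cited for KIND∕locus only).
0 sorry; no new axioms.
-/

noncomputable section

open scoped BigOperators
open Metric Set Finset

namespace Summit.QuantumFields.BalabanUV.T4Continuum.B13BaseInsDatum

open Literature.MathematicalPhysics.QuantumFieldTheory.Balaban1983to89.T4OutputRate (Carriers Functional DecayBound)
open Literature.MathematicalPhysics.QuantumFieldTheory.Balaban1983to89.T4InputCauchyRateData (StepModel tableA tableB sliceAt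
  sliceAt_apply_of_eq sliceAt_apply_of_ne)
open Literature.MathematicalPhysics.QuantumFieldTheory.Balaban1983to89.T4InputCauchyRateSpecies (ballClass BaseBudget BoxInClass)
open Literature.MathematicalPhysics.QuantumFieldTheory.Balaban1983to89.T4InputCauchyRateSecant (HistBudgetA)
open Summit.QuantumFields.BalabanUV.T4Continuum.B13HistInsertion (InsDatum)
open Summit.QuantumFields.BalabanUV.T4Continuum.B13Base

variable {C : Carriers} {IOp Op Hist : Type*} [NormedAddCommGroup Op] [NormedSpace ℂ Op] [NormedAddCommGroup Hist]
  [NormedSpace ℂ Hist]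

/-! ## §1 The slice budget at an arbitrary datum and the (1.36) mechanism on `InsDatum` -/

section Mechanism

variable (D : InsDatum C IOp Hist) (M : StepModel C Op Hist)

/-- [folklore] HYPOTHESIS SHAPE `SliceBudgetAt κ c aOf` (ONE run, displayed): row O1-c's AGE-FREE W3 binder `InsDatum.SliceBudget`
read at an arbitrary insertion-operator datum map `aOf` instead of run A's — a table supported on the scale `j < k` with entries
`≤ T·e^{−κd}` is inserted by the slice `slice k j (aOf g U k)`, before age weighting, with norm `≤ rHist k·c·T`.  At `aOf = D.insOpA`
it IS `D.SliceBudget` (`sliceBudgetAt_insOpA`); at `aOf = D.insOpB` it is the B-twin leaf L03 consumes (printed KIND: the `j`-th term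
of the one-run sums (1.24) p. 7 ∕ (1.29) ∕ (1.36) p. 9 of [Balaban1988RG2Cluster] at the inductive level; NOT PRINTED as a statement
about arbitrary tables). -/
def SliceBudgetAt (W : Set (ℕ → ℝ)) (κ c : ℝ) (aOf : (ℕ → ℝ) → C.BgB → ℕ → IOp) : Prop :=
  ∀ k, ∀ g ∈ W, ∀ (U : C.BgB) (j : ℕ) (T : ℝ) (t : C.Dom → ℝ), j < k → 0 ≤ T →
    (∀ Y, C.scale Y ≠ j → t Y = 0) → (∀ Y, C.scale Y = j → |t Y| ≤ T * Real.exp (-(κ * C.d Y))) →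
      ‖D.slice k j (aOf g U k) t‖ ≤ M.rHist k * (c * T)

/-- [folklore] At run A's datum the shape IS row O1-c's `SliceBudget` (definitionally). -/
theorem sliceBudgetAt_insOpA {W : Set (ℕ → ℝ)} {κ c : ℝ} : SliceBudgetAt D M W κ c D.insOpA ↔ D.SliceBudget M W κ c := Iff.rfl

/-- [folklore] Run B's base part as a history-valued data map (the history component of the self-centred class centre). -/
def baseB (g : ℕ → ℝ) (U : C.BgB) (k : ℕ) : Hist := D.base k (D.insOpB g U k)

/-- [folklore] Run A's base part as a data map. -/
def baseA (g : ℕ → ℝ) (U : C.BgB) (k : ℕ) : Hist := D.base k (D.insOpA g U k)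

variable {D M}

/-- [folklore] A slice reads only its own scale: `slice k j a t = slice k j a (sliceAt j t)`. -/
theorem slice_eq_slice_sliceAt (k j : ℕ) (a : IOp) (t : C.Dom → ℝ) : D.slice k j a t = D.slice k j a (sliceAt j t) :=
  D.slice_local k j a t (sliceAt j t) fun _ hY => (sliceAt_apply_of_eq hY).symm

/-- [folklore] The table-driven part of the insertion is the age-weighted slice sum: `ins k a t − base k a = Σ_{j<k} ω^{k−1−j}•slice`. -/
theorem ins_sub_base (k : ℕ) (a : IOp) (t : C.Dom → ℝ) :
    D.ins k a t - D.base k a = ∑ j ∈ range k, ((D.ω ^ (k - 1 - j) : ℝ) : ℂ) • D.slice k j a t := by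
  rw [InsDatum.ins, add_sub_cancel_left]

/-- [folklore] **SLICE LEVELS ⟹ DISPLACEMENT**: with `0 ≤ ω` and per-scale slice bounds `‖slice k j a t‖ ≤ B j` (`j < k`),
`‖ins k a t − base k a‖ ≤ Σ_{j<k} ω^{k−1−j}·B j` (triangle inequality on the age-weighted sum). -/
theorem norm_ins_sub_base_le_sum {k : ℕ} {a : IOp} {t : C.Dom → ℝ} {B : ℕ → ℝ} (hω : 0 ≤ D.ω)
    (hB : ∀ j < k, ‖D.slice k j a t‖ ≤ B j) : ‖D.ins k a t - D.base k a‖ ≤ ∑ j ∈ range k, D.ω ^ (k - 1 - j) * B j := by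
  rw [ins_sub_base]
  refine (norm_sum_le _ _).trans (sum_le_sum fun j hj => ?_)
  rw [norm_smul, Complex.norm_real, Real.norm_eq_abs, abs_of_nonneg (pow_nonneg hω _)]
  exact mul_le_mul_of_nonneg_left (hB j (mem_range.1 hj)) (pow_nonneg hω _)

/-- [folklore] **THE (1.36) MECHANISM ON `InsDatum`**: under `SliceBudgetAt κ c aOf`, `0 ≤ c`, `0 ≤ ω < 1`, a table whose entries
below scale `k` have one-run level `T·e^{−κd}` (`0 ≤ T`) moves the step-`k` insertion at the datum `aOf g U k` off its base part by
at most `T · rHist k · c/(1 − ω)` — slice locality, the slice budget scale by scale, the geometric age sum. -/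
theorem norm_ins_sub_base_le_insDatum {W : Set (ℕ → ℝ)} {κ c : ℝ} {aOf : (ℕ → ℝ) → C.BgB → ℕ → IOp}
    (hb : SliceBudgetAt D M W κ c aOf) (hc : 0 ≤ c) (hω : 0 ≤ D.ω) (hω1 : D.ω < 1) {k : ℕ} {g : ℕ → ℝ} (hg : g ∈ W)
    (U : C.BgB) {T : ℝ} (hT : 0 ≤ T) {t : C.Dom → ℝ} (ht : ∀ Y, C.scale Y < k → |t Y| ≤ T * Real.exp (-(κ * C.d Y))) :
    ‖D.ins k (aOf g U k) t - D.base k (aOf g U k)‖ ≤ T * (M.rHist k * (c / (1 - D.ω))) := by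
  have hslice : ∀ j < k, ‖D.slice k j (aOf g U k) t‖ ≤ M.rHist k * (c * T) := fun j hj => by
    rw [slice_eq_slice_sliceAt]
    exact hb k g hg U j T (sliceAt j t) hj hT (fun Y hY => sliceAt_apply_of_ne hY) fun Y hY => by
      rw [sliceAt_apply_of_eq hY]; exact ht Y (hY ▸ hj)
  calc ‖D.ins k (aOf g U k) t - D.base k (aOf g U k)‖
      ≤ ∑ j ∈ range k, D.ω ^ (k - 1 - j) * (M.rHist k * (c * T)) := norm_ins_sub_base_le_sum hω hslice
    _ = (M.rHist k * (c * T)) * ∑ j ∈ range k, D.ω ^ (k - 1 - j) := by rw [mul_sum]; exact sum_congr rfl fun j _ => mul_comm _ _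
    _ ≤ (M.rHist k * (c * T)) * (1 / (1 - D.ω)) :=
        mul_le_mul_of_nonneg_left (sum_pow_age_pred_le hω hω1 k)
          (mul_nonneg (M.rHist_pos k).le (mul_nonneg hc hT))
    _ = T * (M.rHist k * (c / (1 - D.ω))) := by rw [mul_one_div, mul_div_assoc]; ring

end Mechanism

/-! ## §2 Run B's history budget (leaf L03's history half) and the A-twin, from the printed one-run levels -/

section Budgets

variable {D : InsDatum C IOp Hist} {M : StepModel C Op Hist} {W : Set (ℕ → ℝ)}

/-- [folklore] **RUN B'S (1.36)-BUDGET FROM LEAF L06 THROUGH ROW O1-c's CLASS**: `ReadsB` (the step model's `insB` IS the datum's),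
`SliceBudgetAt κ c D.insOpB` (the B-twin of row O1-c's age-free W3 binder), `DecayBound EB W E₀ κ` ([Balaban1987RG1] (1.18) p. 263 —
quoted SHAPE, leaf L06), `0 ≤ E₀`, `0 ≤ c`, `0 ≤ ω < 1`, and a centre whose history component is run B's base part ⟹
`HistBudgetB M EB W ctr (k ↦ E₀·rHist k·c/(1 − ω))`. -/
theorem histBudgetB_of_insDatum {EB : Functional C C.BgB} {ctr : ℕ → (ℕ → ℝ) → C.BgB → Op × Hist} {κ E₀ c : ℝ}
    (hB : D.ReadsB M W) (hb : SliceBudgetAt D M W κ c D.insOpB) (hdB : DecayBound EB W E₀ κ) (hE₀ : 0 ≤ E₀) (hc : 0 ≤ c)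
    (hω : 0 ≤ D.ω) (hω1 : D.ω < 1) (hctr : ∀ k (g : ℕ → ℝ) (U : C.BgB), (ctr k g U).2 = baseB D g U k) :
    HistBudgetB M EB W ctr fun k => E₀ * (M.rHist k * (c / (1 - D.ω))) := by
  intro k g hg U
  change ‖M.insB g U k (tableB EB g U) - (ctr k g U).2‖ ≤ E₀ * (M.rHist k * (c / (1 - D.ω)))
  rw [hB k g hg U, hctr k g U]
  exact norm_ins_sub_base_le_insDatum hb hc hω hω1 hg U hE₀ fun Y _ => hdB g hg U Y

/-- [folklore] **THE A-TWIN, feeding the secant face's `HistBudgetA` BY NAME**: `ReadsA`, row O1-c's own `SliceBudget κ c` (run A's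
datum), `DecayBound EA W EA₀ κ` (leaf L05), signs, and a displayed per-step bound `β k` on the distance of run A's base part from the
centre's history component (for the self-centred centre of §3: the two runs' base parts' discrepancy — an NE2-TYPE input of the
insertion-operator data, node U1a's, displayed) ⟹ `HistBudgetA M ctr EA W (k ↦ β k + EA₀·rHist k·c/(1 − ω))`. -/
theorem histBudgetA_of_insDatum {EA : Functional C C.BgA} {ctr : ℕ → (ℕ → ℝ) → C.BgB → Op × Hist} {κ EA₀ c : ℝ} {β : ℕ → ℝ}
    (hA : D.ReadsA M W) (hb : D.SliceBudget M W κ c) (hdA : DecayBound EA W EA₀ κ) (hEA₀ : 0 ≤ EA₀) (hc : 0 ≤ c) (hω : 0 ≤ D.ω)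
    (hω1 : D.ω < 1) (hβ : ∀ k, ∀ g ∈ W, ∀ U : C.BgB, ‖baseA D g U k - (ctr k g U).2‖ ≤ β k) :
    HistBudgetA M ctr EA W fun k => β k + EA₀ * (M.rHist k * (c / (1 - D.ω))) := by
  intro k g hg U
  change ‖M.insA g U k (tableA EA g U) - (ctr k g U).2‖ ≤ β k + EA₀ * (M.rHist k * (c / (1 - D.ω)))
  rw [hA k g hg U]
  calc ‖D.insA g U k (tableA EA g U) - (ctr k g U).2‖
      ≤ ‖D.insA g U k (tableA EA g U) - baseA D g U k‖ + ‖baseA D g U k - (ctr k g U).2‖ :=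
        norm_sub_le_norm_sub_add_norm_sub _ _ _
    _ ≤ EA₀ * (M.rHist k * (c / (1 - D.ω))) + β k :=
        add_le_add (norm_ins_sub_base_le_insDatum ((sliceBudgetAt_insOpA D M).2 hb) hc hω hω1 hg U hEA₀
          fun Y _ => hdA g hg (C.transport U) Y) (hβ k g hg U)
    _ = β k + EA₀ * (M.rHist k * (c / (1 - D.ω))) := add_comm _ _

end Budgets

/-! ## §3 Assembled for the owner's `B13Step`: install the budget box about run B's own operators and base part -/

section Assembled

variable {D : InsDatum C IOp Hist} {M : StepModel C Op Hist} {W : Set (ℕ → ℝ)}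

/-- [folklore] The budget box of the self-centred instance over row O1-c's class: centre `selfCtr M (baseB D)` (run B's own step
operators, run B's base part), budgets `(0, E₀·rHist k·c/(1 − ω))` — the design's RULE R5 base in the self-centred dictionary. -/
def insDatumBudgetBase (M : StepModel C Op Hist) (D : InsDatum C IOp Hist) (E₀ c : ℝ) : ℕ → (ℕ → ℝ) → C.BgB → Set (Op × Hist) :=
  ballClass (selfCtr M (baseB D)) 0 fun k => E₀ * (M.rHist k * (c / (1 - D.ω)))

/-- [folklore] **LEAF L03 ∧ `BaseBudget` FOR THE INSTALLED MODEL, FROM ROW O1-c's READING, ITS B-SIDE SLICE BUDGET AND LEAF L06**: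
`ReadsB ∧ SliceBudgetAt κ c D.insOpB ∧ DecayBound EB W E₀ κ` (+ `0 ≤ E₀`, `0 ≤ c`, `0 ≤ ω < 1`) ⟹ for
`M.withBase (insDatumBudgetBase M D E₀ c)`: `InBase EB W` and `BaseBudget … (selfCtr M (baseB D)) 0 (k ↦ E₀·rHist k·c/(1 − ω))`;
every other END-face binder transfers from `M` unchanged (`B13Base.withBase_binders`). -/
theorem inBase_baseBudget_of_insDatum {EB : Functional C C.BgB} {κ E₀ c : ℝ} (hB : D.ReadsB M W)
    (hb : SliceBudgetAt D M W κ c D.insOpB) (hdB : DecayBound EB W E₀ κ) (hE₀ : 0 ≤ E₀) (hc : 0 ≤ c) (hω : 0 ≤ D.ω)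
    (hω1 : D.ω < 1) :
    (M.withBase (insDatumBudgetBase M D E₀ c)).InBase EB W ∧
      BaseBudget (M.withBase (insDatumBudgetBase M D E₀ c)) W (selfCtr M (baseB D)) 0
        fun k => E₀ * (M.rHist k * (c / (1 - D.ω))) := by
  have h : HasBudgetBase (M.withBase (insDatumBudgetBase M D E₀ c)) (selfCtr M (baseB D)) 0
      fun k => E₀ * (M.rHist k * (c / (1 - D.ω))) :=
    hasBudgetBase_withBase M _ _ _
  have hB' : D.ReadsB (M.withBase (insDatumBudgetBase M D E₀ c)) W := hB
  have hb' : SliceBudgetAt D (M.withBase (insDatumBudgetBase M D E₀ c)) W κ c D.insOpB := hb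
  exact ⟨inBase_of_budgets h (opBudgetB_selfCtr _ (baseB D) W)
      (histBudgetB_of_insDatum hB' hb' hdB hE₀ hc hω hω1 fun _ _ _ => rfl),
    baseBudget_of_hasBudgetBase h W⟩

/-- [folklore] **ROOM ⟹ SLACK** for the installed model: class radii `ROp k ≥ rOp k` and `RHist k ≥ E₀·rHist k·c/(1 − ω) + rHist k` put the
two-margin box around every base point inside `ballClass (selfCtr M (baseB D)) ROp RHist` — the roomy class on which the wall O2
(`ClassBound` ∕ `ClassLineAnalytic`) is to be asserted. -/
theorem boxInClass_of_insDatum {E₀ c : ℝ} {ROp RHist : ℕ → ℝ} (hOp : ∀ k, M.rOp k ≤ ROp k)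
    (hHist : ∀ k, E₀ * (M.rHist k * (c / (1 - D.ω))) + M.rHist k ≤ RHist k) :
    BoxInClass (M.withBase (insDatumBudgetBase M D E₀ c)) (ballClass (selfCtr M (baseB D)) ROp RHist) W :=
  boxInClass_of_hasBudgetBase (hasBudgetBase_withBase M _ _ _) W (fun k => by rw [Pi.zero_apply, zero_add]; exact hOp k) hHist

end Assembled

/-! ## §4 The operator half of L03 in row O1-b's typing: the zero-centred format-ball dictionary -/

section OpFormat

open Summit.QuantumFields.BalabanUV.T4Continuum.B13OpDatum (Format OpDatum InFormat assemble norm_assemble_le)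

variable {E : Type*} (F : Format E) {M : StepModel C (OpDatum E) Hist} {W : Set (ℕ → ℝ)}

/-- [folklore] **OPERATOR BUDGET FROM THE ONE-RUN FORMAT BOUND** (row O1-b's typing): if run B's step-`k` operator datum is the packaged
raw kernel `assemble F (raw g U k)` and the raw kernel obeys the displayed one-run format bound `InFormat F (raw g U k) (R k)` with
`0 ≤ R k` ([Balaban1988RG2Cluster] (1.5)∕(1.7) p. 3 — KIND only), then `OpBudgetB M W ctr R` about any centre with operator component `0`
(`B13OpDatum.norm_assemble_le` BY NAME). -/
theorem opBudgetB_of_inFormat {raw : (ℕ → ℝ) → C.BgB → ℕ → E → ℂ} {R : ℕ → ℝ}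
    {ctr : ℕ → (ℕ → ℝ) → C.BgB → OpDatum E × Hist} (hop : ∀ k, ∀ g ∈ W, ∀ U : C.BgB, M.opB g U k = assemble F (raw g U k))
    (hfmt : ∀ k, ∀ g ∈ W, ∀ U : C.BgB, InFormat F (raw g U k) (R k)) (hR : ∀ k, 0 ≤ R k)
    (hctr : ∀ k (g : ℕ → ℝ) (U : C.BgB), (ctr k g U).1 = 0) : OpBudgetB M W ctr R := by
  intro k g hg U
  rw [hctr k g U, sub_zero, hop k g hg U]
  exact norm_assemble_le (hfmt k g hg U) (hR k)

/-- [folklore] **LEAF L03 IN THE ZERO-CENTRED DICTIONARY**: budget-box base with centre `(0, baseB D)`, operator budget `R` from the format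
bound, history budget `E₀·rHist·c/(1 − ω)` from row O1-c's class and leaf L06 ⟹ `InBase`. -/
theorem inBase_of_inFormat_insDatum {D : InsDatum C IOp Hist} {raw : (ℕ → ℝ) → C.BgB → ℕ → E → ℂ} {R : ℕ → ℝ}
    {EB : Functional C C.BgB} {κ E₀ c : ℝ}
    (h : HasBudgetBase M (fun k g U => (0, baseB D g U k)) R fun k => E₀ * (M.rHist k * (c / (1 - D.ω))))
    (hop : ∀ k, ∀ g ∈ W, ∀ U : C.BgB, M.opB g U k = assemble F (raw g U k))
    (hfmt : ∀ k, ∀ g ∈ W, ∀ U : C.BgB, InFormat F (raw g U k) (R k)) (hR : ∀ k, 0 ≤ R k) (hB : D.ReadsB M W)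
    (hb : SliceBudgetAt D M W κ c D.insOpB) (hdB : DecayBound EB W E₀ κ) (hE₀ : 0 ≤ E₀) (hc : 0 ≤ c) (hω : 0 ≤ D.ω)
    (hω1 : D.ω < 1) : M.InBase EB W :=
  inBase_of_budgets h (opBudgetB_of_inFormat F hop hfmt hR fun _ _ _ => rfl)
    (histBudgetB_of_insDatum hB hb hdB hE₀ hc hω hω1 fun _ _ _ => rfl)

end OpFormat

/-! ## §5 A toy `InsDatum`: non-vacuity of §3 -/

section Toy

open Summit.QuantumFields.BalabanUV.T4Continuum.InsertionLinearClass (linToyCarriers)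

/-- [folklore] Toy insertion datum on the class file's toy carriers (`Dom = ℕ`, `scale = id`, `d = 0`), trivial insertion operators:
no base part, the age-free slice of scale `j` = the scale-`j` table entry (as a complex scalar), age damping `ω`. -/
def toyDatum (ω : ℝ) : InsDatum linToyCarriers Unit ℂ where
  base _ _ := 0
  slice _ j _ t := ((t j : ℝ) : ℂ)
  slice_add _ _ _ _ _ := by simp
  slice_smul _ _ _ _ _ := by simp
  slice_local _ j _ _ _ h := by rw [h j rfl]
  ω := ω
  insOpA _ _ _ := ()
  insOpB _ _ _ := ()

/-- [folklore] Toy step model: scalar data, output = operator datum plus history datum, operators `0`, both runs' insertions = the toy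
datum's, PLACEHOLDER base `univ` (replaced by the installer), unit margins. -/
def toyStepI (ω : ℝ) : StepModel linToyCarriers ℂ ℂ where
  Out := fun _ o h _ => o + h
  opA := fun _ _ _ => 0
  opB := fun _ _ _ => 0
  insA := (toyDatum ω).insA
  insB := (toyDatum ω).insB
  Base := fun _ _ _ => Set.univ
  rOp := fun _ => 1
  rHist := fun _ => 1
  rOp_pos := fun _ => one_pos
  rHist_pos := fun _ => one_pos

/-- [folklore] The toy reads the toy datum (run B). -/
theorem toy_readsB (ω : ℝ) : (toyDatum ω).ReadsB (toyStepI ω) Set.univ := fun _ _ _ _ _ => rfl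

/-- [folklore] The toy's slice budget at ANY datum map with `c = 1`: the scale-`j` slice of a table supported on scale `j` with entries
`≤ T` has norm `|t j| ≤ T = rHist·1·T`. -/
theorem toy_sliceBudgetAt (ω κ : ℝ) (aOf : (ℕ → ℝ) → linToyCarriers.BgB → ℕ → Unit) :
    SliceBudgetAt (toyDatum ω) (toyStepI ω) Set.univ κ 1 aOf := by
  intro k g _ U j T t _ _ _ hbd
  change ‖((t j : ℝ) : ℂ)‖ ≤ 1 * (1 * T)
  rw [Complex.norm_real, Real.norm_eq_abs, one_mul, one_mul]
  simpa using hbd j rfl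

/-- [folklore] **NON-VACUITY OF §3**: with `toyEB ≡ 1` (level `E₀ = 1`, `κ = 0`, `B13Base.toy_decayB`) and any `0 ≤ ω < 1`, the installed
toy satisfies `InBase ∧ BaseBudget` with history budget `1·(1·1/(1 − ω))`. -/
theorem toy_inBase_baseBudget {ω : ℝ} (hω : 0 ≤ ω) (hω1 : ω < 1) :
    ((toyStepI ω).withBase (insDatumBudgetBase (toyStepI ω) (toyDatum ω) 1 1)).InBase toyEB Set.univ ∧
      BaseBudget ((toyStepI ω).withBase (insDatumBudgetBase (toyStepI ω) (toyDatum ω) 1 1)) Set.univ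
        (selfCtr (toyStepI ω) (baseB (toyDatum ω))) 0 fun k => 1 * ((toyStepI ω).rHist k * (1 / (1 - (toyDatum ω).ω))) :=
  inBase_baseBudget_of_insDatum (toy_readsB ω) (toy_sliceBudgetAt ω 0 _) toy_decayB zero_le_one zero_le_one hω hω1

end Toy

end Summit.QuantumFields.BalabanUV.T4Continuum.B13BaseInsDatum

end
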